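import Mathlib
import HarnessLib
import Summits.QuantumFields.YangMills.Theses.GronwallGap
import Summits.QuantumFields.YangMills.Theorems.GronwallGapPathGapModulusNearHaarFloor
import Literature.MathematicalPhysics.QuantumFieldTheory.PlaquetteWeightTorusSystem

/-!
# `PathGapModulus` (stmt-QuantumFields-13946), line `registered`, stub `stub_closedOfUniformConstants`

Helper for the crux `Summit.QuantumFields.YangMills.Theses.GronwallGap.PathGapModulus` (route `GronwallGap`).
Stub S3u: rate-`μ` torus clustering with observable-wise uniform constants along parameters accumulating at `s₀`
passes to `s₀` (finite-volume continuity of the plaquette-weight torus state in the path parameter).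

* `continuousWithinAt_integral_groupHeatKernelMeasure` — for a weight path `w : ℝ → G → ℝ` which on a
  parameter set `T ∋ s₀` is continuous and positive on `G`, uniformly bounded, and pointwise continuous in the
  parameter at `s₀`, the finite-volume expectation `s ↦ ∫ X d(groupHeatKernelMeasure w s)` of a bounded
  measurable observable `X` is continuous within `T` at `s₀` (ratio of two dominated-convergence limits);
* `stub_closedOfUniformConstants` — the registered stub.
-/

namespace Summit.QuantumFields.YangMills.Theorems

open MeasureTheory Filter Topology
open Literature.MathematicalPhysics.QuantumFieldTheory
open Literature.MathematicalPhysics.QuantumLattice (configShift toTorusObservable torusLift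
  groupHeatKernelWeight groupHeatKernelMeasure continuous_plaquetteHolonomy)

section Weight

variable {G : Type*} [Group G] {d L : ℕ} [NeZero L]

/-- The plaquette-weight density `∏_q w s (U_q)` is continuous on the torus configurations when
`w s` is continuous. [folklore] -/
theorem continuous_groupHeatKernelWeight [TopologicalSpace G] [IsTopologicalGroup G]
    {w : ℝ → G → ℝ} {s : ℝ} (hw : Continuous (w s)) :
    Continuous fun U : GaugeConfig d L G => groupHeatKernelWeight (d := d) (L := L) w s U := by
  unfold Literature.MathematicalPhysics.QuantumLattice.groupHeatKernelWeight
  exact continuous_finsetProd _ fun _ _ => hw.comp (continuous_plaquetteHolonomy _ _ _)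

/-- The plaquette-weight density is positive when the single-plaquette weight is. [folklore] -/
theorem groupHeatKernelWeight_pos' {w : ℝ → G → ℝ} {s : ℝ} (hw : ∀ g, 0 < w s g)
    (U : GaugeConfig d L G) : 0 < groupHeatKernelWeight (d := d) (L := L) w s U :=
  Finset.prod_pos fun _ _ => hw _

/-- The plaquette-weight density is at most `B ^ #plaquettes` when `0 < w s ≤ B`. [folklore] -/
theorem groupHeatKernelWeight_le_pow' {w : ℝ → G → ℝ} {s : ℝ} (hw : ∀ g, 0 < w s g) {B : ℝ}
    (hB : ∀ g, w s g ≤ B) (U : GaugeConfig d L G) :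
    groupHeatKernelWeight (d := d) (L := L) w s U ≤ B ^ Fintype.card (Plaquette d L) := by
  unfold Literature.MathematicalPhysics.QuantumLattice.groupHeatKernelWeight
  calc ∏ q : Plaquette d L, w s (plaquetteHolonomy U q.1 q.2.1.1 q.2.1.2)
      ≤ ∏ _q : Plaquette d L, B :=
        Finset.prod_le_prod (fun _ _ => (hw _).le) fun _ _ => hB _
    _ = B ^ Fintype.card (Plaquette d L) := by rw [Finset.prod_const, Finset.card_univ]

/-- The plaquette-weight density is continuous in the path parameter (within `T` at `s₀`) at every
configuration when every `s ↦ w s g` is. [folklore] -/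
theorem continuousWithinAt_groupHeatKernelWeight_param {w : ℝ → G → ℝ} {T : Set ℝ} {s₀ : ℝ}
    (hw : ∀ g, ContinuousWithinAt (fun s => w s g) T s₀) (U : GaugeConfig d L G) :
    ContinuousWithinAt (fun s => groupHeatKernelWeight (d := d) (L := L) w s U) T s₀ := by
  unfold Literature.MathematicalPhysics.QuantumLattice.groupHeatKernelWeight
  exact tendsto_finsetProd _ fun _ _ => hw _

end Weight

/-- **Continuity of finite-volume plaquette-weight torus expectations in the path parameter.** Let
`w : ℝ → G → ℝ` be, for every parameter `s` in a set `T ∋ s₀`, continuous and positive on the compact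
group `G`, uniformly bounded on `T × G`, and pointwise continuous in `s` within `T` at `s₀`. Then for
every bounded measurable `X` on the torus configurations,
`s ↦ ∫ X d(groupHeatKernelMeasure w s) = (∫ h_s X dπ) / (∫ h_s dπ)` (`π` = product Haar,
`h_s = ∏_q w s (U_q)`) is continuous within `T` at `s₀`: numerator and denominator are continuous by
dominated convergence and the denominator is positive. [folklore] -/
theorem continuousWithinAt_integral_groupHeatKernelMeasure
    {G : Type*} [Group G] [TopologicalSpace G] [IsTopologicalGroup G] [CompactSpace G]
    [MeasurableSpace G] [BorelSpace G] [SecondCountableTopology G]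
    {d L : ℕ} [NeZero L] {w : ℝ → G → ℝ} {T : Set ℝ} {s₀ : ℝ} (hs₀ : s₀ ∈ T)
    (hcont : ∀ s ∈ T, Continuous (w s)) (hpos : ∀ s ∈ T, ∀ g, 0 < w s g)
    {B : ℝ} (hB : ∀ s ∈ T, ∀ g, w s g ≤ B)
    (hlim : ∀ g, ContinuousWithinAt (fun s => w s g) T s₀)
    {X : GaugeConfig d L G → ℝ} (hXm : Measurable X) {CX : ℝ} (hXb : ∀ U, |X U| ≤ CX) :
    ContinuousWithinAt
      (fun s => ∫ U, X U ∂(groupHeatKernelMeasure (d := d) (L := L) w s)) T s₀ := by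
  -- regularity of the densities `h_s = groupHeatKernelWeight w s` on `T`
  have hhm : ∀ s ∈ T, Measurable fun U : GaugeConfig d L G =>
      groupHeatKernelWeight (d := d) (L := L) w s U := fun s hs =>
    (continuous_groupHeatKernelWeight (hcont s hs)).measurable
  have hhpos : ∀ s ∈ T, ∀ U : GaugeConfig d L G,
      0 < groupHeatKernelWeight (d := d) (L := L) w s U := fun s hs U =>
    groupHeatKernelWeight_pos' (hpos s hs) U
  have hB0 : 0 ≤ B := ((hpos s₀ hs₀ 1).trans_le (hB s₀ hs₀ 1)).le
  have hhabs : ∀ s ∈ T, ∀ U : GaugeConfig d L G,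
      |groupHeatKernelWeight (d := d) (L := L) w s U| ≤ B ^ Fintype.card (Plaquette d L) :=
    fun s hs U => by
    rw [abs_of_pos (hhpos s hs U)]
    exact groupHeatKernelWeight_le_pow' (hpos s hs) (hB s hs) U
  have hint : ∀ s ∈ T, Integrable (fun U : GaugeConfig d L G =>
      groupHeatKernelWeight (d := d) (L := L) w s U)
      (Measure.pi fun _ : Edge d L => haarProbability G) := fun s hs =>
    Integrable.of_bound (hhm s hs).aestronglyMeasurable _ (Eventually.of_forall fun U => by
      rw [Real.norm_eq_abs]; exact hhabs s hs U)
  -- continuity of the weighted integrals of bounded measurable functions (dominated convergence)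
  have hY : ∀ {Y : GaugeConfig d L G → ℝ}, Measurable Y → ∀ {CY : ℝ}, (∀ U, |Y U| ≤ CY) →
      ContinuousWithinAt (fun s => ∫ U, groupHeatKernelWeight (d := d) (L := L) w s U * Y U
        ∂(Measure.pi fun _ : Edge d L => haarProbability G)) T s₀ := by
    intro Y hYm CY hYb
    refine continuousWithinAt_of_dominated
      (bound := fun _ => B ^ Fintype.card (Plaquette d L) * CY) ?_ ?_ (integrable_const _) ?_
    · filter_upwards [self_mem_nhdsWithin] with s hs
      exact ((hhm s hs).mul hYm).aestronglyMeasurable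
    · filter_upwards [self_mem_nhdsWithin] with s hs
      refine Eventually.of_forall fun U => ?_
      rw [Real.norm_eq_abs, abs_mul]
      exact mul_le_mul (hhabs s hs U) (hYb U) (abs_nonneg _) (pow_nonneg hB0 _)
    · exact Eventually.of_forall fun U =>
        (continuousWithinAt_groupHeatKernelWeight_param hlim U).mul continuousWithinAt_const
  -- the expectation as a ratio of weighted integrals
  have hE : ∀ s ∈ T, ∫ U, X U ∂(groupHeatKernelMeasure (d := d) (L := L) w s) =
      (∫ U, groupHeatKernelWeight (d := d) (L := L) w s U * X U
          ∂(Measure.pi fun _ : Edge d L => haarProbability G)) /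
        ∫ U, groupHeatKernelWeight (d := d) (L := L) w s U
          ∂(Measure.pi fun _ : Edge d L => haarProbability G) := fun s hs =>
    integral_normalised_withDensity (Measure.pi fun _ : Edge d L => haarProbability G) (hhm s hs)
      (hhpos s hs) (hint s hs) _
  have hden : ContinuousWithinAt (fun s => ∫ U, groupHeatKernelWeight (d := d) (L := L) w s U
      ∂(Measure.pi fun _ : Edge d L => haarProbability G)) T s₀ := by
    have h1 := hY (Y := fun _ => (1 : ℝ)) measurable_const (CY := 1) (fun U => by simp)
    simpa only [mul_one] using h1
  have hden0 : (∫ U, groupHeatKernelWeight (d := d) (L := L) w s₀ U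
      ∂(Measure.pi fun _ : Edge d L => haarProbability G)) ≠ 0 := by
    refine ((integral_pos_iff_support_of_nonneg (fun U => (hhpos s₀ hs₀ U).le)
      (hint s₀ hs₀)).2 ?_).ne'
    have hsupp : Function.support (fun U : GaugeConfig d L G =>
        groupHeatKernelWeight (d := d) (L := L) w s₀ U) = Set.univ := by
      ext U; simp [(hhpos s₀ hs₀ U).ne']
    rw [hsupp, measure_univ]; exact one_pos
  exact ((hY hXm hXb).div hden hden0).congr (fun s hs => hE s hs) (hE s₀ hs₀)

/-- **Stub S3u — closedness of rate-`μ` clustering under observable-wise uniform constants (PROVABLE).** For every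
compact simple `G` and every admissible weight path `w` (only continuity, positivity and the log-Lipschitz clause of
`Adm` are used): if for every pair of local gauge-invariant observables `A, B` there are constants `C, S₀` such that
parameters `s ∈ [0,1]` arbitrarily close to `s₀` satisfy the rate-`μ` torus clustering bound for `A, B` with THESE
constants, then the `w_(s₀)`-theory clusters volume-uniformly at rate `μ`. Mechanism: for fixed `A, B, S, n` the
finite-volume torus covariance is continuous in `s` (the densities `∏_q w s (U_q)` of `groupHeatKernelMeasure w s`
converge uniformly as `s → s₀`), so the bound passes to the limit. Size: M. [folklore] -/
theorem stub_closedOfUniformConstants :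
    ∀ (G : Type) [Group G] [TopologicalSpace G] [IsTopologicalGroup G] [CompactSpace G],
      Literature.MathematicalPhysics.QuantumFieldTheory.IsCompactSimpleLieGroup G →
      letI : MeasurableSpace G := borel G; haveI : BorelSpace G := ⟨rfl⟩;
      let UCw : (ℝ → G → ℝ) → ℝ → ℝ → Prop := fun w s m => ∀ A B : Literature.MathematicalPhysics.QuantumFieldTheory.YMSpecies G, ∃ C : ℝ, ∃ S₀ : ℕ, ∀ S : ℕ, S₀ ≤ S → ∀ n : ℕ, n ≤ S → |(∫ U, A.F (Literature.MathematicalPhysics.QuantumLattice.torusLift (2 * S + 1) U) * B.F (Literature.MathematicalPhysics.QuantumLattice.configShift (-Pi.single 0 (n : ℤ)) (Literature.MathematicalPhysics.QuantumLattice.torusLift (2 * S + 1) U)) ∂(Literature.MathematicalPhysics.QuantumLattice.groupHeatKernelMeasure (d := 4) (L := 2 * S + 1) w s)) - (∫ U, A.F (Literature.MathematicalPhysics.QuantumLattice.torusLift (2 * S + 1) U) ∂(Literature.MathematicalPhysics.QuantumLattice.groupHeatKernelMeasure (d := 4) (L := 2 * S + 1) w s)) * (∫ U, B.F (Literature.MathematicalPhysics.QuantumLattice.torusLift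 (2 * S + 1) U) ∂(Literature.MathematicalPhysics.QuantumLattice.groupHeatKernelMeasure (d := 4) (L := 2 * S + 1) w s))| ≤ C * Real.exp (-(m * n));
      let Adm : (ℝ → G → ℝ) → Prop := fun w => (∀ s ∈ Set.Icc (0 : ℝ) 1, Continuous (w s) ∧ (∀ g : G, 0 < w s g) ∧ (∀ g h : G, w s (h * g * h⁻¹) = w s g) ∧ (∀ g : G, w s g⁻¹ = w s g) ∧ (∀ (n : ℕ) (x : Fin n → G) (c : Fin n → ℂ), 0 ≤ (∑ i, ∑ j, (starRingEnd ℂ) (c i) * c j * ((w s ((x i)⁻¹ * x j) : ℝ) : ℂ)).re)) ∧ ∃ Λ : ℝ, ∀ s ∈ Set.Icc (0 : ℝ) 1, ∀ s' ∈ Set.Icc (0 : ℝ) 1, ∀ g : G, |Real.log (w s g) - Real.log (w s' g)| ≤ Λ * |s - s'|;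
      ∀ w : ℝ → G → ℝ, Adm w →
        ∀ s₀ ∈ Set.Icc (0 : ℝ) 1, ∀ μ : ℝ, 0 < μ →
          (∀ A B : Literature.MathematicalPhysics.QuantumFieldTheory.YMSpecies G, ∃ C : ℝ, ∃ S₀ : ℕ, ∀ ε : ℝ, 0 < ε → ∃ s ∈ Set.Icc (0 : ℝ) 1, |s - s₀| < ε ∧ ∀ S : ℕ, S₀ ≤ S → ∀ n : ℕ, n ≤ S → |(∫ U, A.F (Literature.MathematicalPhysics.QuantumLattice.torusLift (2 * S + 1) U) * B.F (Literature.MathematicalPhysics.QuantumLattice.configShift (-Pi.single 0 (n : ℤ)) (Literature.MathematicalPhysics.QuantumLattice.torusLift (2 * S + 1) U)) ∂(Literature.MathematicalPhysics.QuantumLattice.groupHeatKernelMeasure (d := 4) (L := 2 * S + 1) w s)) - (∫ U, A.F (Literature.MathematicalPhysics.QuantumLattice.torusLift (2 * S + 1) U) ∂(Literature.MathematicalPhysics.QuantumLattice.groupHeatKernelMeasure (d := 4) (L := 2 * S + 1) w s)) * (∫ U, B.F (Literature.MathematicalPhysics.QuantumLattice.torusLift (2 * S + 1) U) ∂(Literature.MathematicalPhysics.QuantumLattice.groupHeatKernelMeasure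 (d := 4) (L := 2 * S + 1) w s))| ≤ C * Real.exp (-(μ * n))) →
          UCw w s₀ μ := by
  intro G _ _ _ _ hG
  letI : MeasurableSpace G := borel G
  haveI : BorelSpace G := ⟨rfl⟩
  intro UCw Adm w hAdm s₀ hs₀ μ _ hunif A B
  obtain ⟨-, ⟨r⟩⟩ := hG
  haveI : SecondCountableTopology G := secondCountable_of_latticeRep r
  obtain ⟨hreg, Λ, hΛ⟩ := hAdm
  obtain ⟨C, S₀, hC⟩ := hunif A B
  refine ⟨C, S₀, fun S hS n hn => ?_⟩
  -- a uniform bound for the weights on `[0,1]` (log-Lipschitz clause + compactness at `s₀`)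
  obtain ⟨hc₀, hp₀, -⟩ := hreg s₀ hs₀
  obtain ⟨M₀, hM₀⟩ : ∃ M₀ : ℝ, ∀ g, w s₀ g ≤ M₀ := by
    obtain ⟨g₀, -, hg₀⟩ := isCompact_univ.exists_isMaxOn Set.univ_nonempty hc₀.continuousOn
    exact ⟨w s₀ g₀, fun g => hg₀ (Set.mem_univ g)⟩
  have hB : ∀ s ∈ Set.Icc (0 : ℝ) 1, ∀ g, w s g ≤ M₀ * Real.exp |Λ| := fun s hs g => by
    have h1 := hΛ s hs s₀ hs₀ g
    have hss : |s - s₀| ≤ 1 := by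
      rw [abs_le]; constructor <;> linarith [hs.1, hs.2, hs₀.1, hs₀.2]
    have h3 : Λ * |s - s₀| ≤ |Λ| :=
      calc Λ * |s - s₀| ≤ |Λ| * |s - s₀| :=
            mul_le_mul_of_nonneg_right (le_abs_self Λ) (abs_nonneg _)
        _ ≤ |Λ| * 1 := mul_le_mul_of_nonneg_left hss (abs_nonneg _)
        _ = |Λ| := mul_one _
    have h2 : Real.log (w s g) ≤ Real.log (w s₀ g) + |Λ| := by
      have := (abs_le.1 h1).2
      linarith
    have hps := (hreg s hs).2.1 g
    calc w s g = Real.exp (Real.log (w s g)) := (Real.exp_log hps).symm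
      _ ≤ Real.exp (Real.log (w s₀ g) + |Λ|) := Real.exp_le_exp.2 h2
      _ = w s₀ g * Real.exp |Λ| := by rw [Real.exp_add, Real.exp_log (hp₀ g)]
      _ ≤ M₀ * Real.exp |Λ| := mul_le_mul_of_nonneg_right (hM₀ g) (Real.exp_pos _).le
  -- pointwise continuity of the weights in the parameter (log-Lipschitz clause)
  have hlim : ∀ g, ContinuousWithinAt (fun s => w s g) (Set.Icc (0 : ℝ) 1) s₀ := fun g => by
    have hlog : ContinuousWithinAt (fun s => Real.log (w s g)) (Set.Icc (0 : ℝ) 1) s₀ := by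
      rw [Metric.continuousWithinAt_iff]
      intro ε hε
      refine ⟨ε / (|Λ| + 1), div_pos hε (by positivity), fun s hs hd => ?_⟩
      rw [Real.dist_eq] at hd ⊢
      calc |Real.log (w s g) - Real.log (w s₀ g)| ≤ Λ * |s - s₀| := hΛ s hs s₀ hs₀ g
        _ ≤ (|Λ| + 1) * |s - s₀| :=
            mul_le_mul_of_nonneg_right (by linarith [le_abs_self Λ]) (abs_nonneg _)
        _ < (|Λ| + 1) * (ε / (|Λ| + 1)) := mul_lt_mul_of_pos_left hd (by positivity)
        _ = ε := by field_simp
    have hexp : ContinuousWithinAt (fun s => Real.exp (Real.log (w s g))) (Set.Icc (0 : ℝ) 1) s₀ :=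
      Real.continuous_exp.continuousAt.comp_continuousWithinAt hlog
    exact hexp.congr (fun s hs => (Real.exp_log ((hreg s hs).2.1 g)).symm)
      (Real.exp_log (hp₀ g)).symm
  -- continuity of the finite-volume expectations of bounded measurable observables
  have key : ∀ {X : GaugeConfig 4 (2 * S + 1) G → ℝ}, Measurable X → ∀ {CX : ℝ},
      (∀ U, |X U| ≤ CX) →
      ContinuousWithinAt (fun s => ∫ U, X U
        ∂(Literature.MathematicalPhysics.QuantumLattice.groupHeatKernelMeasure (d := 4)
          (L := 2 * S + 1) w s)) (Set.Icc (0 : ℝ) 1) s₀ :=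
    fun hXm _ hXb => continuousWithinAt_integral_groupHeatKernelMeasure hs₀
      (fun s hs => (hreg s hs).1) (fun s hs => (hreg s hs).2.1) hB hlim hXm hXb
  obtain ⟨CA, hCA⟩ := A.bounded
  obtain ⟨CB, hCB⟩ := B.bounded
  have hmA : Measurable fun U : GaugeConfig 4 (2 * S + 1) G => A.F (torusLift (2 * S + 1) U) :=
    A.measurable.comp (measurable_torusLift _)
  have hmB : Measurable fun U : GaugeConfig 4 (2 * S + 1) G => B.F (torusLift (2 * S + 1) U) :=
    B.measurable.comp (measurable_torusLift _)
  have hmAB : Measurable fun U : GaugeConfig 4 (2 * S + 1) G =>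
      A.F (torusLift (2 * S + 1) U) *
        B.F (configShift (-Pi.single 0 (n : ℤ)) (torusLift (2 * S + 1) U)) :=
    hmA.mul (B.measurable.comp ((configShift _).measurable.comp (measurable_torusLift _)))
  have hbAB : ∀ U : GaugeConfig 4 (2 * S + 1) G,
      |A.F (torusLift (2 * S + 1) U) *
        B.F (configShift (-Pi.single 0 (n : ℤ)) (torusLift (2 * S + 1) U))| ≤ CA * CB := fun U => by
    rw [abs_mul]
    exact mul_le_mul (hCA _) (hCB _) (abs_nonneg _) ((abs_nonneg _).trans (hCA (torusLift _ U)))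
  have h1 := key hmAB hbAB
  have h2 := key hmA fun U => hCA _
  have h3 := key hmB fun U => hCB _
  -- the finite-volume covariance as a function of the parameter
  let f : ℝ → ℝ := fun s =>
    (∫ U, A.F (torusLift (2 * S + 1) U) *
        B.F (configShift (-Pi.single 0 (n : ℤ)) (torusLift (2 * S + 1) U))
      ∂(Literature.MathematicalPhysics.QuantumLattice.groupHeatKernelMeasure (d := 4)
        (L := 2 * S + 1) w s)) -
    (∫ U, A.F (torusLift (2 * S + 1) U)
      ∂(Literature.MathematicalPhysics.QuantumLattice.groupHeatKernelMeasure (d := 4)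
        (L := 2 * S + 1) w s)) *
    (∫ U, B.F (torusLift (2 * S + 1) U)
      ∂(Literature.MathematicalPhysics.QuantumLattice.groupHeatKernelMeasure (d := 4)
        (L := 2 * S + 1) w s))
  have hf : ContinuousWithinAt f (Set.Icc (0 : ℝ) 1) s₀ := h1.sub (h2.mul h3)
  change |f s₀| ≤ C * Real.exp (-(μ * n))
  -- pass to the limit along parameters obeying the bound
  refine le_of_forall_pos_lt_add fun η hη => ?_
  obtain ⟨δ, hδ, hδf⟩ := Metric.continuousWithinAt_iff.1 hf η hη
  obtain ⟨s, hs, hsd, hsb⟩ := hC δ hδ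
  have hb : |f s| ≤ C * Real.exp (-(μ * n)) := hsb S hS n hn
  have hd : |f s - f s₀| < η := by
    have := hδf hs (by rwa [Real.dist_eq])
    rwa [Real.dist_eq] at this
  linarith [abs_sub_abs_le_abs_sub (f s₀) (f s), abs_sub_comm (f s₀) (f s)]

end Summit.QuantumFields.YangMills.Theorems
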